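import Literature.NumberTheory.Sieve.GreenTao2008SharpGYDiagonal
import HarnessLib

/-!
# Maynard (2016), Lemma 6: `Σ_{p ∣ N} log p / p ≪ (log log N)²` (the "bad primes" of (6.13)–(6.14))

Trunk: AntSieve / parity (Maynard 2016 large-gaps ladder, named fact
`Literature.NumberTheory.Sieve.Maynard2016.Lemma6MainTerm` of `Maynard2016Lemma6Split.lean`).

J. Maynard, *Large gaps between primes*, Ann. of Math. 183 (2016) = arXiv:1408.5110, §6, proof of
Lemma 6, displays (6.13)–(6.14): the primes `w < p` which divide `m` or one of the numbers
`m q (h_j − h_i) − 1` contribute a factor `∏_p (1 + O(k² log p √(log x)/(p log y)))` to the Euler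
product, and "this is `exp(O(w⁻¹ + (log₂ x)²/((log x)^{1/2−ε})))`" ((6.14)) because all these primes
divide one integer `N' ≤ x^{O(k²)}` and **`Σ_{p ∣ N'} log p/p ≪ (log log N')²`**.  This file proves
the latter elementary estimate in the explicit form
`Maynard2016.sum_primeFactors_log_div_le : 16 ≤ N → Σ_{p ∣ N} log p/p ≤ (log log N + 3)²`
(split at `L = log N`: primes `≤ L` give `≤ log L · (1 + log L)` by the harmonic bound, the at most
`log₂ N` primes `> L` give `≤ log L/L` each since `t ↦ log t/t` decreases on `[e, ∞)`, and
`#{p ∣ N} log 2 ≤ log N` is the tree's `GreenTao2008.SharpGY.card_primeFactors_mul_log_two_le`).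

## References

* J. Maynard, *Large gaps between primes*, Ann. of Math. (2) 183 (2016), 915–933; arXiv:1408.5110,
  §6, proof of Lemma 6, displays (6.13)–(6.14). [Maynard2016LargeGaps]
-/

noncomputable section

open Filter Finset
open scoped BigOperators

namespace Literature.NumberTheory.Sieve

namespace Maynard2016

/-! ### `ω(N) ≤ log₂ N` is `GreenTao2008.SharpGY.card_primeFactors_mul_log_two_le` -/

/-! ### The harmonic bound over primes `≤ L` -/

/-- `Σ_{n=1}^{M} 1/n ≤ 1 + log M`, real form of `harmonic_le_one_add_log`. [folklore] -/
private theorem sum_Icc_inv_le_one_add_log (M : ℕ) :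
    ∑ n ∈ Finset.Icc 1 M, (n : ℝ)⁻¹ ≤ 1 + Real.log M := by
  have h := harmonic_le_one_add_log M
  rw [harmonic_eq_sum_Icc] at h
  push_cast at h
  exact h

/-- Primes `p ≤ L` dividing `N`: `Σ log p/p ≤ log L · (1 + log L)` (`L ≥ 1`). [cite: Maynard2016LargeGaps, §6 display (6.14)] -/
theorem sum_primeFactors_small_le {N : ℕ} {L : ℝ} (hL : 1 ≤ L) :
    ∑ p ∈ N.primeFactors.filter (fun p : ℕ => (p : ℝ) ≤ L), Real.log p / p ≤
      Real.log L * (1 + Real.log L) := by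
  have hlogL : 0 ≤ Real.log L := Real.log_nonneg hL
  set S := N.primeFactors.filter (fun p : ℕ => (p : ℝ) ≤ L) with hS
  have h1 : ∑ p ∈ S, Real.log p / p ≤ ∑ p ∈ S, Real.log L * (p : ℝ)⁻¹ := by
    refine Finset.sum_le_sum fun p hp => ?_
    obtain ⟨hpN, hpL⟩ := Finset.mem_filter.1 hp
    have hp0 : (0 : ℝ) < p := by exact_mod_cast (Nat.prime_of_mem_primeFactors hpN).pos
    rw [div_eq_mul_inv]
    exact mul_le_mul_of_nonneg_right (Real.log_le_log hp0 hpL) (inv_nonneg.2 hp0.le)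
  refine h1.trans ?_
  rw [← Finset.mul_sum]
  refine mul_le_mul_of_nonneg_left ?_ hlogL
  have hfloor : 1 ≤ ⌊L⌋₊ := Nat.one_le_floor_iff _ |>.2 hL
  have hsub : S ⊆ Finset.Icc 1 ⌊L⌋₊ := by
    intro p hp
    obtain ⟨hpN, hpL⟩ := Finset.mem_filter.1 hp
    exact Finset.mem_Icc.2 ⟨(Nat.prime_of_mem_primeFactors hpN).one_lt.le, Nat.le_floor hpL⟩
  calc ∑ p ∈ S, (p : ℝ)⁻¹ ≤ ∑ n ∈ Finset.Icc 1 ⌊L⌋₊, (n : ℝ)⁻¹ :=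
        Finset.sum_le_sum_of_subset_of_nonneg hsub fun n _ _ => by positivity
    _ ≤ 1 + Real.log (⌊L⌋₊ : ℕ) := sum_Icc_inv_le_one_add_log _
    _ ≤ 1 + Real.log L := by
        have h0 : (0 : ℝ) < ⌊L⌋₊ := by exact_mod_cast hfloor
        linarith [Real.log_le_log h0 (Nat.floor_le (by linarith : (0 : ℝ) ≤ L))]

/-! ### Primes `p > L` dividing `N` -/

/-- Primes `p > L ≥ e` dividing `N ≠ 0`: `Σ log p/p ≤ ω(N) · log L/L ≤ (log N/log 2) · log L/L`.
[cite: Maynard2016LargeGaps, §6 display (6.14)] -/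
theorem sum_primeFactors_large_le {N : ℕ} (hN : N ≠ 0) {L : ℝ} (hL : Real.exp 1 ≤ L) :
    ∑ p ∈ N.primeFactors.filter (fun p : ℕ => ¬ (p : ℝ) ≤ L), Real.log p / p ≤
      Real.log N / Real.log 2 * (Real.log L / L) := by
  set S := N.primeFactors.filter (fun p : ℕ => ¬ (p : ℝ) ≤ L) with hS
  have h1 : ∑ p ∈ S, Real.log p / p ≤ ∑ p ∈ S, Real.log L / L := by
    refine Finset.sum_le_sum fun p hp => ?_
    obtain ⟨hpN, hpL⟩ := Finset.mem_filter.1 hp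
    rw [not_le] at hpL
    exact Real.log_div_self_antitoneOn hL (Set.mem_Ici.2 (hL.trans hpL.le)) hpL.le
  refine h1.trans ?_
  rw [Finset.sum_const, nsmul_eq_mul]
  have hLpos : 0 < L := lt_of_lt_of_le (Real.exp_pos 1) hL
  have hlogL : 0 ≤ Real.log L := Real.log_nonneg (by linarith [Real.add_one_le_exp (1 : ℝ)])
  refine mul_le_mul_of_nonneg_right ?_ (div_nonneg hlogL hLpos.le)
  have hlog2 : 0 < Real.log 2 := Real.log_pos one_lt_two
  rw [le_div_iff₀ hlog2]
  calc (S.card : ℝ) * Real.log 2 ≤ N.primeFactors.card * Real.log 2 := by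
        exact mul_le_mul_of_nonneg_right (by rw [hS]; exact_mod_cast Finset.card_filter_le _ _) hlog2.le
    _ ≤ Real.log N := GreenTao2008.SharpGY.card_primeFactors_mul_log_two_le hN

/-! ### The estimate -/

/-- **`Σ_{p ∣ N} log p / p ≤ (log log N + 3)²` for `N ≥ 16`** (`16 > e^e`, so `L = log N ≥ e`).
[cite: Maynard2016LargeGaps, §6 display (6.14)] -/
theorem sum_primeFactors_log_div_le {N : ℕ} (hN : 16 ≤ N) :
    ∑ p ∈ N.primeFactors, Real.log p / p ≤ (Real.log (Real.log N) + 3) ^ 2 := by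
  have hN0 : N ≠ 0 := by omega
  set L := Real.log N with hLdef
  -- `e ≤ L`: `e < 2.72`, `2.72 ≤ log 16 = 4 log 2`, `log 2 > 0.69`.
  have hL : Real.exp 1 ≤ L := by
    have h16 : Real.log 16 ≤ L := Real.log_le_log (by norm_num) (by exact_mod_cast hN)
    have h2 : Real.log 16 = 4 * Real.log 2 := by
      rw [show (16 : ℝ) = 2 ^ 4 by norm_num, Real.log_pow]; norm_num
    linarith [Real.exp_one_lt_d9, Real.log_two_gt_d9]
  have he1 : 1 ≤ Real.exp 1 := by linarith [Real.add_one_le_exp (1 : ℝ)]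
  have hL1 : 1 ≤ L := he1.trans hL
  have hLpos : 0 < L := by linarith
  have hlogL : 1 ≤ Real.log L := by
    rw [← Real.log_exp 1]; exact Real.log_le_log (Real.exp_pos 1) hL
  rw [← Finset.sum_filter_add_sum_filter_not N.primeFactors (fun p : ℕ => (p : ℝ) ≤ L)]
  have h1 := sum_primeFactors_small_le (N := N) hL1
  have h2 := sum_primeFactors_large_le hN0 hL
  -- `(log N/log 2)(log L/L) = log L/log 2 ≤ 2 log L`
  have h3 : Real.log N / Real.log 2 * (Real.log L / L) ≤ 2 * Real.log L := by
    rw [← hLdef]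
    have hlog2 : 0 < Real.log 2 := Real.log_pos one_lt_two
    rw [div_mul_div_comm, div_le_iff₀ (mul_pos hlog2 hLpos)]
    nlinarith [Real.log_two_gt_d9, mul_pos hLpos (by linarith : (0 : ℝ) < Real.log L)]
  nlinarith

/-- **Monotone form**: for a finite set `S` of primes all dividing `N ≥ 16`,
`Σ_{p ∈ S} log p / p ≤ (log log N + 3)²`. [cite: Maynard2016LargeGaps, §6 display (6.14)] -/
theorem sum_log_div_le_of_dvd {N : ℕ} (hN : 16 ≤ N) {S : Finset ℕ}
    (hS : ∀ p ∈ S, p.Prime ∧ p ∣ N) :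
    ∑ p ∈ S, Real.log p / p ≤ (Real.log (Real.log N) + 3) ^ 2 := by
  have hsub : S ⊆ N.primeFactors := fun p hp =>
    Nat.mem_primeFactors.2 ⟨(hS p hp).1, (hS p hp).2, by omega⟩
  refine le_trans ?_ (sum_primeFactors_log_div_le hN)
  refine Finset.sum_le_sum_of_subset_of_nonneg hsub fun p hp _ => ?_
  have hp := Nat.prime_of_mem_primeFactors hp
  exact div_nonneg (Real.log_nonneg (by exact_mod_cast hp.one_lt.le)) (Nat.cast_nonneg _)

end Maynard2016

end Literature.NumberTheory.Sieve

end
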